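import Literature.MathematicalPhysics.QuantumFieldTheory.Balaban1983to89.B9Eq321RofUReadingZdPer
import Literature.MathematicalPhysics.QuantumFieldTheory.Balaban1983to89.B5Eq190FlatCoercivitySpacingUniform

/-!
# `Balaban1983to89.B9Eq190FlatCoercivityZdPer` — [Balaban1984PropagatorsI] Prop. 1.1 (1.90) p. 33 («Δ_a = G⁻¹ ≥ γ₀(Δ + I)», «γ₀ independent of k, T_η»)
# FOR [Balaban1985BackgroundPropagators] (3.26) p. 395 ∕ Thm 3.11 p. 416 AT THE FLAT BACKGROUND, READ ON THE N06 PERIODIC CARRIER IN MIXED CURRENCY —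
# bridge storey S4 (partial): for a `P`-periodic HERMITIAN `𝔸`-valued bond field `A` on `ℤᵈ`, `P = Lᵏ·n`, the EXPLICIT, volume-free flat coercivity of the
# pub-balaban NE9 chain (`B5Eq190FlatCoercivitySpacingUniform.flat_coercive_spacing_uniform`, from N02's kernel-certified (1.90)) reads
# `γ·c₀·Σ_μΣ_{[0,P)ᵈ}|A|²_τ ≤ c₀·Σ_κΣ_{ν<κ}Σ_{[0,P)ᵈ}|(D¹A)_{νκ}|²_τ + c₀·Σ_{[0,P)ᵈ}|R(1)(D¹*A)|²_τ + a·‖Q^{(Lᵏ)}(1)x_A‖²`,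
# `γ = (1∕((d+1)·Cst d 1))·min(a·c₁∕(c₀·Lᵏᵈ), 1)` — the `D*D`-square and the `R`-square (dag-n06-w4's `projRPer`) in the junction's trace currency by storeys
# S1∕S2, the `Q`-square left in the NE9 currency `QtorusW (Lᵏ) (n,…,n) … 1` for storey S3

statement-level skeleton of published theorems with citation tags; proofs where landed; nothing here is a claim about the
Yang–Mills mass gap

`[Balaban1984PropagatorsI]` ("B5", CMP **95** (1984) 17–40) Prop. 1.1 p. 33: *«‖GJ‖, ‖∇GJ‖, … ≤ γ₀⁻¹‖J‖, (1.89) with a positive constant γ₀ independent of k,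
T_η, and depending on d only (if we put a = 1). This implies the bound from below: Δ_a = G⁻¹ ≥ γ₀(Δ + I). (1.90)»*, (1.69) p. 29 *«⟨A, Δ_a A⟩ = ⟨A, ∂*∂A⟩ +
⟨A, ∂R∂*A⟩ + a⟨A, Q*QA⟩»*; `[Balaban1985BackgroundPropagators]` ("B9") (3.26) p. 395 *«Δ₁(U) = Δ(U) + D₁R(U)D₁* + Q*(U)aQ(U)»*, p. 395 *«It coincides with Δ_a in
(2.19) [of Propagators II] if U = 1»*, Thm 3.11 p. 416 *«In [4] we have proved that the operator G_□(1) is positive»*.  PDF held: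
`paper:balaban1984-cmp95-propagators-rt-i` p. 33 (via the tree's `B5Eq190FlatCoercivity(Spacing)Uniform` ∕ `B5Prop11Lower` docstrings, whose render-read
quotations these are; re-read 2026-08-28).

CITATION HEADER (lean-in-tree rule).  Cell `pub-ymgap` (YM Track A, HUMAN RULINGS D-0062 ∕ D-0149), node N06 = [B9], width seat `pub-ymgap-dag-n06-w3` (g6),
bridge storey S4-partial (LOCATED-BRIDGE bus 2026-08-28 14:27Z; memo `HOME/pub-ymgap-dag-n06-w3/BRIDGE-NE9-PERIODIC-g6.md`).  WHY.  The N06 binder on the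
(β′-PERIODIC) road (`InvAtHIPer` ⇐ positivity of the genuine periodic form, dag-n06-b) and every near-flat road to it (dag-n06-w4's (3.25) chain) start
from the FLAT coercivity of the genuine four-letter bond form on `T_P`.  N02 certified [B5] (1.90) (`B5Prop11Lower`); the pub-balaban NE9 chain transported it
to its `W`-valued torus letters with an explicit, volume- and spacing-free constant (`flat_coercive_spacing_uniform`) and split the flat form into three
squares (`B5Eq190FlatCoercivityUniform.re_inner_flat_eq_three_sq`).  THIS FILE reads that inequality on the N06 periodic carrier through the bridge:
`W := EuclideanSpace ℂ (Fin n)`, `φ` τ-isometric (`B9HilbertSchmidtFibreCoordinates`, hypothesis `hφ`), `U := 1`, `α := 0` (`B5Eq172FlatCoercivity.hU1_one ∕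
hreg_one`); the `L²` norm and the `D*D`-square by S1 (`B9Eq315PeriodicReadingZdPer`), the `R`-square by S2 (`B9Eq321RofUReadingZdPer.read_RofU_one_eq_projRPer`).
The `Q`-square is kept in NE9 currency (storey S3 reads it into dag-n06-b's `QQZdP`∕`linCovIterT` at `torusIdx`).

WHAT IS PROVED (kernel, 0 sorry, 0 def).
* §1 readings: `norm_sq_fibre_eq_re_trace` (`‖v‖² = Re τ((φv)*(φv))`), ★ `norm_sq_bondL2K_read` (`‖x‖² = c₀·Σ_μΣ_{box P} Re τ(A*A)`, `A` the reading of `x`),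
  `map_covCurl_flat_torus`, ★ `norm_sq_covCurlL2K_one_read` (`‖D¹x‖² = c₀·Σ_κΣ_{ν<κ}Σ_{box}|(plaqCovDeriv η 1 A)_{νκ}|²_τ`), `read_covDivL2K_one`
  (`D¹*x` reads as `covDivB η 1 A`), `isSelfAdjoint_covDivB_one` (Hermitian for Hermitian `A`), ★ `norm_sq_RofU_covDivL2K_one_read`
  (`‖R(1)D¹*x‖² = c₀·Σ_{box}|projRPer … 1 (covDivB η 1 A)|²_τ` for Hermitian readings — S2).
* §2 ★★★ `flat_coercive_read_mixed` ([B5] (1.90) ON THE N06 PERIODIC CARRIER, MIXED CURRENCY — statement in the header) and ★★ `flat_coercive_periodic_herm`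
  (the same for a GIVEN periodic Hermitian `A : ℤᵈ × dirs → 𝔸`, with `x_A := φ⁻¹ ∘ A ∘ liftSite` the torus function it reads).

HONEST SCOPE.  Count-neutral helper (`--supports` the K1 item of record): an IMPORT of N02's kernel-certified (1.90) through the NE9 chain and this seat's
bridge — the constant `(1∕((d+1)·B5Prop11Plancherel.Cst d 1))·min(a·c₁∕(c₀Lᵏᵈ),1)` is N02's∕NE9's, no new estimate is proved here; ONE averaging level (the torus
datum), flat background only, `Q`-square not yet in the junction's letters (S3), `[Nontrivial 𝔸]` for NE9's `NormOneClass`; Thm 3.11 ∕ 3.3 at `U₀ ≠ 1` NOT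
proved; N05 ∕ N06 NOT discharged; K1 NOT closed; one finite `𝕋⁴` programme at fixed `ε`, Bałaban as printed; R4 closes only the conditional finite-`𝕋⁴` rung
`BalabanLadder.UV` — nothing continuum ∕ ℝ⁴ ∕ OS ∕ mass gap ∕ Clay.  Unit `pub-ymgap-dag-n06-w3` (g6), 2026-08-28; NEW file importing `B9Eq321RofUReadingZdPer`
and `B5Eq190FlatCoercivitySpacingUniform`; modifies nothing.  Net new unproved facts: 0.
-/

noncomputable section

open scoped BigOperators InnerProductSpace ComplexConjugate

namespace Literature.MathematicalPhysics.QuantumFieldTheory.Balaban1983to89.B9Eq190FlatCoercivityZdPer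

open B4Sect5Torus (TSite)
open B9SectCLatticeCarrier (Bond DirPair)
open B9Eq311L2Pairing (WL2)
open B11Eq103H1Complex (SiteL2K BondL2K covDivL2K equiv_covDivL2K)
open B9Eq310HessianOperator (adTransportW covCurlL2K equiv_covCurlL2K PlaqL2K)
open B9Eq33CovDerivVector (covDiv)
open B9Eq34CovCurlVector (covCurl covCurl_apply_coord)
open B9Eq315QTorus (perSite perCfg perCfg_apply QtorusW)
open B9Eq315QTorusOnto (liftSite perSite_liftSite)
open B9Eq319QprimeTorus (fineP)
open B9Eq326OperatorAssembly (RofU)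
open B5Eq172HodgePositivity (adTransportW_one)
open B5Eq172FlatCoercivity (hU1_one hreg_one)
open B5Eq190FlatCoercivityUniform (re_inner_flat_eq_three_sq)
open B5Eq190FlatCoercivitySpacingUniform (flat_coercive_spacing_uniform)
open B7Prop2Explicit (unitaryUnits)
open B8Ineq132 (covDeriv)
open B8Eq146AExpansion (plaqCovDeriv)
open B8Eq138LandauZd (covDivB)
open T4TermwiseTorus (IsPeriodic box)
open B9Eq321LandauProjectionZd (star_covDeriv)
open B9Eq321LandauProjectionZdPer (projRPer)
open B9Eq315PeriodicReadingZdPer (sum_box_eq_sum_univ_liftSite sum_box_plaqCovDeriv_eq_sum_plaq_covCurl covDiv_flat_perSite comp_perSite_liftSite_restrict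
  isPeriodic_perCfg)
open B9Eq321ProjectionTransportZdPer (re_inner_siteL2K_eq_mul_sum_box map_covDiv_flat_torus)
open B9Eq321RofUReadingZdPer (read_RofU_one_eq_projRPer)

variable {d : ℕ}

/-! ## §1  The norms of the NE9 `L²` spaces and the flat letters, read on the N06 periodic carrier -/

section Readings

variable (L' : ℕ) [NeZero L'] (n : ℕ) [NeZero n] {𝔸 : Type*} [CStarAlgebra 𝔸] (τ : 𝔸 →ₗ[ℂ] ℂ) {n' : ℕ} {c₀ : ℝ} [Fact (0 < c₀)] (η : ℝ)
  (φ : EuclideanSpace ℂ (Fin n') ≃ₗ[ℂ] 𝔸) (hφ : ∀ x y : EuclideanSpace ℂ (Fin n'), τ (star (φ x) * φ y) = ⟪x, y⟫_ℂ)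

omit [NeZero L'] [NeZero n] [Fact (0 < c₀)] in
include hφ in
/-- the fibre norm in trace currency: `‖v‖² = Re τ((φv)* (φv))`. [cite: Balaban1985BackgroundPropagators, p.390 («|X|² = tr X*X»)] -/
theorem norm_sq_fibre_eq_re_trace (v : EuclideanSpace ℂ (Fin n')) : ‖v‖ ^ 2 = (τ (star (φ v) * φ v)).re := by
  rw [← @inner_self_eq_norm_sq ℂ, ← hφ]
  rfl

include hφ in
/-- ★ **THE NE9 BOND `L²` NORM IN TRACE CURRENCY**: `‖x‖² = c₀·Σ_μ Σ_{z∈[0,P)ᵈ} Re τ(A(z)_μ* A(z)_μ)`, `A` the reading of `x` on `ℤᵈ` (`P = L′·n` constant periods).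
[cite: Balaban1985BackgroundPropagators, (3.11) p.392, p.390] -/
theorem norm_sq_bondL2K_read (x : BondL2K ℂ d (fineP L' (fun _ : Fin d => n)) c₀ (EuclideanSpace ℂ (Fin n'))) :
    ‖x‖ ^ 2 = c₀ * ∑ μ : Fin d, ∑ z ∈ box (d := d) (L' * n),
      (τ (star (φ (WL2.equiv ℂ _ _ x (perSite (fineP L' (fun _ : Fin d => n)) z, μ))) *
        φ (WL2.equiv ℂ _ _ x (perSite (fineP L' (fun _ : Fin d => n)) z, μ)))).re := by
  rw [WL2.norm_sq, Fintype.sum_prod_type, Finset.mul_sum, Finset.sum_comm]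
  refine Finset.sum_congr rfl fun μ _ => ?_
  rw [Finset.mul_sum, sum_box_eq_sum_univ_liftSite (L' * n)]
  refine Finset.sum_congr rfl fun y _ => ?_
  rw [norm_sq_fibre_eq_re_trace τ φ hφ, perSite_liftSite]

omit [NeZero L'] [NeZero n] [Fact (0 < c₀)] in
/-- the fibre coordinates commute with the flat curl (3.4) of `B9Eq34CovCurlVector`. [cite: Balaban1985BackgroundPropagators, (3.4) p.391] -/
theorem map_covCurl_flat_torus (c : ℂ) (B : Bond d (fineP L' (fun _ : Fin d => n)) → EuclideanSpace ℂ (Fin n'))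
    (p : B9SectCLatticeCarrier.Plaq d (fineP L' (fun _ : Fin d => n))) :
    φ (covCurl c (fun _ => LinearMap.id) B p) = covCurl c (fun _ => LinearMap.id) (fun b => φ (B b)) p := by
  obtain ⟨y, q⟩ := p
  rw [covCurl_apply_coord, covCurl_apply_coord, map_sub, map_smul, map_smul]
  simp only [LinearMap.id_apply, map_sub]

include hφ in
/-- ★ **THE `D*D`-SQUARE READ ON `ℤᵈ`**: `‖covCurlL2K ℂ c₀ (↑η)⁻¹ (adTransportW φ 1) x‖² = c₀·Σ_κ Σ_{ν<κ} Σ_{z∈[0,P)ᵈ} Re τ(|(plaqCovDeriv η 1 A)_{νκ}(z)|²)` — storey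
S1's `sum_box_plaqCovDeriv_eq_sum_plaq_covCurl`. [cite: Balaban1985BackgroundPropagators, (3.4) p.391, (3.10) p.392] -/
theorem norm_sq_covCurlL2K_one_read (x : BondL2K ℂ d (fineP L' (fun _ : Fin d => n)) c₀ (EuclideanSpace ℂ (Fin n'))) :
    ‖covCurlL2K ℂ c₀ (((η : ℂ))⁻¹) (adTransportW φ fun _ : Bond d (fineP L' (fun _ : Fin d => n)) => (1 : 𝔸ˣ)) x‖ ^ 2 =
      c₀ * ∑ κ : Fin d, ∑ ν ∈ Finset.Iio κ, ∑ z ∈ box (d := d) (L' * n),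
        (τ (star (plaqCovDeriv η (1 : B7Prop1Explicit.Site d → Fin d → 𝔸ˣ)
              (fun w μ => φ (WL2.equiv ℂ _ _ x (perSite (fineP L' (fun _ : Fin d => n)) w, μ))) ν κ z) *
            plaqCovDeriv η (1 : B7Prop1Explicit.Site d → Fin d → 𝔸ˣ)
              (fun w μ => φ (WL2.equiv ℂ _ _ x (perSite (fineP L' (fun _ : Fin d => n)) w, μ))) ν κ z)).re := by
  have hT : (adTransportW φ fun _ : Bond d (fineP L' (fun _ : Fin d => n)) => (1 : 𝔸ˣ)) = fun _ => LinearMap.id :=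
    funext fun b => adTransportW_one φ b
  have hfine : (fun _ : Fin d => L' * n) = fineP L' (fun _ : Fin d => n) := rfl
  have hread : (fun w μ => φ (WL2.equiv ℂ _ _ x (perSite (fineP L' (fun _ : Fin d => n)) w, μ))) =
      perCfg (fun _ : Fin d => L' * n) (fun b => φ (WL2.equiv ℂ _ _ x b)) := by
    funext w μ; rw [perCfg_apply]
  rw [hread, sum_box_plaqCovDeriv_eq_sum_plaq_covCurl (L' * n) η (fun b => φ (WL2.equiv ℂ _ _ x b)) (fun a => (τ (star a * a)).re),
    WL2.norm_sq, Finset.mul_sum]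
  refine Finset.sum_congr rfl fun p _ => ?_
  rw [norm_sq_fibre_eq_re_trace τ φ hφ, equiv_covCurlL2K, hT, map_covCurl_flat_torus, Complex.ofReal_inv]

/-- **`D¹*x` READS AS `covDivB η 1 A`** (S1's `covDiv_flat_perSite` through the fibre coordinates). [cite: Balaban1985BackgroundPropagators, (3.8) p.392] -/
theorem read_covDivL2K_one (x : BondL2K ℂ d (fineP L' (fun _ : Fin d => n)) c₀ (EuclideanSpace ℂ (Fin n'))) (z : B7Prop1Explicit.Site d) :
    φ (WL2.equiv ℂ _ _ (covDivL2K ℂ c₀ (((η : ℂ))⁻¹) (adTransportW φ fun b : Bond d (fineP L' (fun _ : Fin d => n)) =>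
        ((fun _ => (1 : 𝔸ˣ)) b)⁻¹) x) (perSite (fineP L' (fun _ : Fin d => n)) z)) =
      covDivB η (1 : B7Prop1Explicit.Site d → Fin d → 𝔸ˣ) (fun w μ => φ (WL2.equiv ℂ _ _ x (perSite (fineP L' (fun _ : Fin d => n)) w, μ))) z := by
  have hT : (adTransportW φ fun b : Bond d (fineP L' (fun _ : Fin d => n)) => ((fun _ => (1 : 𝔸ˣ)) b)⁻¹) = fun _ => LinearMap.id := by
    have h1 : (fun b : Bond d (fineP L' (fun _ : Fin d => n)) => ((fun _ => (1 : 𝔸ˣ)) b)⁻¹) = fun _ => (1 : 𝔸ˣ) := funext fun _ => inv_one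
    rw [h1]; exact funext fun b => adTransportW_one φ b
  have hread : (fun w μ => φ (WL2.equiv ℂ _ _ x (perSite (fineP L' (fun _ : Fin d => n)) w, μ))) =
      perCfg (fun _ : Fin d => L' * n) (fun b => φ (WL2.equiv ℂ _ _ x b)) := by
    funext w μ; rw [perCfg_apply]
  rw [equiv_covDivL2K, hT, map_covDiv_flat_torus, hread]
  have h := covDiv_flat_perSite (L' * n) η (fun b => φ (WL2.equiv ℂ _ _ x b)) z
  rw [Complex.ofReal_inv] at h
  exact h

omit [NeZero L'] [NeZero n] [Fact (0 < c₀)] in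
/-- the flat divergence of a Hermitian bond field is Hermitian (w4 g0's `star_covDeriv` at the unitary background `1`).
[cite: Balaban1985BackgroundPropagators, (3.8) p.392, p.391] -/
theorem isSelfAdjoint_covDivB_one {A : B7Prop1Explicit.Site d → Fin d → 𝔸} (hA : ∀ w μ, IsSelfAdjoint (A w μ)) (z : B7Prop1Explicit.Site d) :
    IsSelfAdjoint (covDivB η (1 : B7Prop1Explicit.Site d → Fin d → 𝔸ˣ) A z) := by
  have hU : ∀ (w : B7Prop1Explicit.Site d) (κ : Fin d), (1 : B7Prop1Explicit.Site d → Fin d → 𝔸ˣ) w κ ∈ unitaryUnits 𝔸 :=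
    fun _ _ => (unitaryUnits 𝔸).one_mem
  rw [IsSelfAdjoint, covDivB, star_sum]
  refine Finset.sum_congr rfl fun μ _ => ?_
  rw [star_covDeriv η hU]
  congr 1
  funext w
  exact (hA w μ).star_eq

end Readings

/-! ## §2  [B5] (1.90) on the N06 periodic carrier, mixed currency -/

section Coercive

variable (L : ℕ) [NeZero L] (k n : ℕ) [NeZero n] {𝔸 : Type*} [CStarAlgebra 𝔸] [Nontrivial 𝔸] [FiniteDimensional ℝ 𝔸]
  (τ : 𝔸 →ₗ[ℂ] ℂ) {n' : ℕ} {c₀ c₁ : ℝ} [Fact (0 < c₀)] [Fact (0 < c₁)] (η a : ℝ)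
  (φ : EuclideanSpace ℂ (Fin n') ≃ₗ[ℂ] 𝔸)

omit [Nontrivial 𝔸] in
include τ in
/-- ★ **THE `R`-SQUARE READ ON `ℤᵈ`** (storey S2): for a Hermitian reading `A` of `x`, `‖R^{(Lᵏ)}(1)(D¹*x)‖² = c₀·Σ_{z∈[0,P)ᵈ} |projRPer τ P L k η Λs 1 (covDivB η 1 A)(z)|²_τ`.
[cite: Balaban1985BackgroundPropagators, (3.21)–(3.22) p.394, (3.8) p.392] -/
theorem norm_sq_RofU_covDivL2K_one_read (hτs : ∀ b : 𝔸, τ (star b) = starRingEnd ℂ (τ b)) (hτp : ∀ b : 𝔸, b ≠ 0 → 0 < (τ (star b * b)).re)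
    (hτt : ∀ b b' : 𝔸, τ (b * b') = τ (b' * b)) (hφ : ∀ x y : EuclideanSpace ℂ (Fin n'), τ (star (φ x) * φ y) = ⟪x, y⟫_ℂ) (hL : 1 ≤ L)
    (Λs : ℕ → Set (B7Prop1Explicit.Site d)) (hΛk : Λs k = Set.univ) (hΛlt : ∀ j, j < k → Λs j = ∅)
    (x : BondL2K ℂ d (fineP (L ^ k) (fun _ : Fin d => n)) c₀ (EuclideanSpace ℂ (Fin n')))
    (hHerm : ∀ (w : B7Prop1Explicit.Site d) (μ : Fin d), IsSelfAdjoint (φ (WL2.equiv ℂ _ _ x (perSite (fineP (L ^ k) (fun _ : Fin d => n)) w, μ)))) :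
    ‖RofU (L ^ k) (fun _ : Fin d => n) φ η (fun _ => (1 : 𝔸ˣ))
        (covDivL2K ℂ c₀ (((η : ℂ))⁻¹) (adTransportW φ fun b : Bond d (fineP (L ^ k) (fun _ : Fin d => n)) => ((fun _ => (1 : 𝔸ˣ)) b)⁻¹) x)‖ ^ 2 =
      c₀ * ∑ z ∈ box (d := d) (L ^ k * n),
        (τ (star (projRPer τ (L ^ k * n) L k η Λs (1 : B7Prop1Explicit.Site d → Fin d → 𝔸ˣ)
              (covDivB η (1 : B7Prop1Explicit.Site d → Fin d → 𝔸ˣ)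
                (fun w μ => φ (WL2.equiv ℂ _ _ x (perSite (fineP (L ^ k) (fun _ : Fin d => n)) w, μ)))) z) *
            projRPer τ (L ^ k * n) L k η Λs (1 : B7Prop1Explicit.Site d → Fin d → 𝔸ˣ)
              (covDivB η (1 : B7Prop1Explicit.Site d → Fin d → 𝔸ˣ)
                (fun w μ => φ (WL2.equiv ℂ _ _ x (perSite (fineP (L ^ k) (fun _ : Fin d => n)) w, μ)))) z)).re := by
  set u := covDivL2K ℂ c₀ (((η : ℂ))⁻¹) (adTransportW φ fun b : Bond d (fineP (L ^ k) (fun _ : Fin d => n)) => ((fun _ => (1 : 𝔸ˣ)) b)⁻¹) x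
    with hu
  -- the reading of `u = D¹*x` is `covDivB η 1 A`, Hermitian
  have hru : (fun z => φ (WL2.equiv ℂ _ _ u (perSite (fineP (L ^ k) (fun _ : Fin d => n)) z))) =
      covDivB η (1 : B7Prop1Explicit.Site d → Fin d → 𝔸ˣ)
        (fun w μ => φ (WL2.equiv ℂ _ _ x (perSite (fineP (L ^ k) (fun _ : Fin d => n)) w, μ))) := by
    funext z; rw [hu]; exact read_covDivL2K_one (L ^ k) n η φ x z
  have hHu : ∀ z : B7Prop1Explicit.Site d, IsSelfAdjoint (φ (WL2.equiv ℂ _ _ u (perSite (fineP (L ^ k) (fun _ : Fin d => n)) z))) := by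
    intro z
    rw [congr_fun hru z]
    exact isSelfAdjoint_covDivB_one η hHerm z
  have hR := read_RofU_one_eq_projRPer L k n τ η φ hτs hτp hτt hφ hL Λs hΛk hΛlt u hHu
  rw [@norm_sq_eq_re_inner ℂ, re_inner_siteL2K_eq_mul_sum_box (L ^ k * n) τ φ hφ]
  refine congrArg (c₀ * ·) (Finset.sum_congr rfl fun z _ => ?_)
  have hz := congr_fun hR z
  simp only at hz
  rw [hru] at hz
  have hz' : φ (WL2.equiv ℂ _ _ (RofU (L ^ k) (fun _ : Fin d => n) φ η (fun _ => (1 : 𝔸ˣ)) u) (perSite (fun _ : Fin d => L ^ k * n) z)) =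
      projRPer τ (L ^ k * n) L k η Λs (1 : B7Prop1Explicit.Site d → Fin d → 𝔸ˣ)
        (covDivB η (1 : B7Prop1Explicit.Site d → Fin d → 𝔸ˣ)
          (fun w μ => φ (WL2.equiv ℂ _ _ x (perSite (fineP (L ^ k) (fun _ : Fin d => n)) w, μ)))) z := hz
  rw [hz']

/-- ★★★ **[B5] (1.90) ON THE N06 PERIODIC CARRIER, MIXED CURRENCY**: for `x` in the NE9 bond space on the fine torus of periods `Lᵏ·n` whose reading `A` on `ℤᵈ`
is HERMITIAN-valued, `0 < η`, `η·Lᵏ ≤ 1`, `0 < a`: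
`γ·c₀·Σ_μΣ_{[0,P)ᵈ} Re τ(A*A) ≤ c₀·Σ_κΣ_{ν<κ}Σ_{[0,P)ᵈ} Re τ|(D¹A)_{νκ}|² + c₀·Σ_{[0,P)ᵈ} Re τ|projRPer…1(D¹*A)|² + a·‖QtorusW (Lᵏ) (n,…,n) … 1 x‖²`,
`γ = (1∕((d+1)·Cst d 1))·min(a·c₁∕(c₀·Lᵏᵈ), 1)` — NE9's `flat_coercive_spacing_uniform` + `re_inner_flat_eq_three_sq` at `(W, φ) = (EuclideanSpace, φ)`, `U = 1`,
`α = 0`, read through S1 and S2. [cite: Balaban1984PropagatorsI, Prop. 1.1 (1.90) p.33, (1.69) p.29; Balaban1985BackgroundPropagators, (3.26) p.395, Thm 3.11 p.416] -/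
theorem flat_coercive_read_mixed (hτs : ∀ b : 𝔸, τ (star b) = starRingEnd ℂ (τ b)) (hτp : ∀ b : 𝔸, b ≠ 0 → 0 < (τ (star b * b)).re)
    (hτt : ∀ b b' : 𝔸, τ (b * b') = τ (b' * b)) (hφ : ∀ x y : EuclideanSpace ℂ (Fin n'), τ (star (φ x) * φ y) = ⟪x, y⟫_ℂ) (hL : 1 ≤ L)
    (hη0 : 0 < η) (hηL : η * (L ^ k : ℕ) ≤ 1) (ha : 0 < a)
    (Λs : ℕ → Set (B7Prop1Explicit.Site d)) (hΛk : Λs k = Set.univ) (hΛlt : ∀ j, j < k → Λs j = ∅)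
    (x : BondL2K ℂ d (fineP (L ^ k) (fun _ : Fin d => n)) c₀ (EuclideanSpace ℂ (Fin n')))
    (hHerm : ∀ (w : B7Prop1Explicit.Site d) (μ : Fin d), IsSelfAdjoint (φ (WL2.equiv ℂ _ _ x (perSite (fineP (L ^ k) (fun _ : Fin d => n)) w, μ)))) :
    (1 / ((d + 1 : ℝ) * B5Prop11Plancherel.Cst d 1)) * min (a * c₁ / (c₀ * ((L ^ k : ℕ) : ℝ) ^ d)) 1 *
        (c₀ * ∑ μ : Fin d, ∑ z ∈ box (d := d) (L ^ k * n),
          (τ (star (φ (WL2.equiv ℂ _ _ x (perSite (fineP (L ^ k) (fun _ : Fin d => n)) z, μ))) *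
            φ (WL2.equiv ℂ _ _ x (perSite (fineP (L ^ k) (fun _ : Fin d => n)) z, μ)))).re) ≤
      c₀ * (∑ κ : Fin d, ∑ ν ∈ Finset.Iio κ, ∑ z ∈ box (d := d) (L ^ k * n),
          (τ (star (plaqCovDeriv η (1 : B7Prop1Explicit.Site d → Fin d → 𝔸ˣ)
                (fun w μ => φ (WL2.equiv ℂ _ _ x (perSite (fineP (L ^ k) (fun _ : Fin d => n)) w, μ))) ν κ z) *
              plaqCovDeriv η (1 : B7Prop1Explicit.Site d → Fin d → 𝔸ˣ)
                (fun w μ => φ (WL2.equiv ℂ _ _ x (perSite (fineP (L ^ k) (fun _ : Fin d => n)) w, μ))) ν κ z)).re) +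
      c₀ * (∑ z ∈ box (d := d) (L ^ k * n),
          (τ (star (projRPer τ (L ^ k * n) L k η Λs (1 : B7Prop1Explicit.Site d → Fin d → 𝔸ˣ)
                (covDivB η (1 : B7Prop1Explicit.Site d → Fin d → 𝔸ˣ)
                  (fun w μ => φ (WL2.equiv ℂ _ _ x (perSite (fineP (L ^ k) (fun _ : Fin d => n)) w, μ)))) z) *
              projRPer τ (L ^ k * n) L k η Λs (1 : B7Prop1Explicit.Site d → Fin d → 𝔸ˣ)
                (covDivB η (1 : B7Prop1Explicit.Site d → Fin d → 𝔸ˣ)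
                  (fun w μ => φ (WL2.equiv ℂ _ _ x (perSite (fineP (L ^ k) (fun _ : Fin d => n)) w, μ)))) z)).re) +
      a * ‖QtorusW (L ^ k) (fun _ : Fin d => n) (Nat.one_le_pow k L hL) φ (fun _ => (1 : 𝔸ˣ)) (α := 0) (by norm_num)
            (hU1_one (L ^ k) (fun _ : Fin d => n)) (hreg_one (L ^ k) (fun _ : Fin d => n)) (c₁ := c₁) x‖ ^ 2 := by
  have hco := flat_coercive_spacing_uniform (L ^ k) (fun _ : Fin d => n) (Nat.one_le_pow k L hL) φ (α := 0) (by norm_num)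
    (hU1_one (L ^ k) (fun _ : Fin d => n)) (hreg_one (L ^ k) (fun _ : Fin d => n)) (c₁ := c₁) ha hη0 hηL x
  rw [re_inner_flat_eq_three_sq, norm_sq_bondL2K_read (L ^ k) n τ φ hφ x, norm_sq_covCurlL2K_one_read (L ^ k) n τ η φ hφ x,
    norm_sq_RofU_covDivL2K_one_read L k n τ η φ hτs hτp hτt hφ hL Λs hΛk hΛlt x hHerm] at hco
  rw [Finset.mul_sum] at hco ⊢
  exact hco

/-- ★★ **[B5] (1.90) FOR A GIVEN PERIODIC HERMITIAN BOND FIELD ON `ℤᵈ`** (`A ∈ domSubHPer P` in dag-n06-b's carrier, `P = Lᵏ·n`): the torus function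
`x_A := φ⁻¹ ∘ A ∘ liftSite` reads back to `A` (periodicity), so `flat_coercive_read_mixed` applies with `A` in place of the reading — the `Q`-square being
`a·‖QtorusW (Lᵏ) (n,…,n) … 1 x_A‖²`. [cite: Balaban1984PropagatorsI, Prop. 1.1 (1.90) p.33; Balaban1985BackgroundPropagators, (3.26)–(3.27) p.395, Thm 3.11 p.416] -/
theorem flat_coercive_periodic_herm (hτs : ∀ b : 𝔸, τ (star b) = starRingEnd ℂ (τ b)) (hτp : ∀ b : 𝔸, b ≠ 0 → 0 < (τ (star b * b)).re)
    (hτt : ∀ b b' : 𝔸, τ (b * b') = τ (b' * b)) (hφ : ∀ x y : EuclideanSpace ℂ (Fin n'), τ (star (φ x) * φ y) = ⟪x, y⟫_ℂ) (hL : 1 ≤ L)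
    (hη0 : 0 < η) (hηL : η * (L ^ k : ℕ) ≤ 1) (ha : 0 < a)
    (Λs : ℕ → Set (B7Prop1Explicit.Site d)) (hΛk : Λs k = Set.univ) (hΛlt : ∀ j, j < k → Λs j = ∅)
    {A : B7Prop1Explicit.Site d → Fin d → 𝔸} (hAper : IsPeriodic (L ^ k * n) A) (hAherm : ∀ w μ, IsSelfAdjoint (A w μ)) :
    (1 / ((d + 1 : ℝ) * B5Prop11Plancherel.Cst d 1)) * min (a * c₁ / (c₀ * ((L ^ k : ℕ) : ℝ) ^ d)) 1 *
        (c₀ * ∑ μ : Fin d, ∑ z ∈ box (d := d) (L ^ k * n), (τ (star (A z μ) * A z μ)).re) ≤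
      c₀ * (∑ κ : Fin d, ∑ ν ∈ Finset.Iio κ, ∑ z ∈ box (d := d) (L ^ k * n),
          (τ (star (plaqCovDeriv η (1 : B7Prop1Explicit.Site d → Fin d → 𝔸ˣ) A ν κ z) *
            plaqCovDeriv η (1 : B7Prop1Explicit.Site d → Fin d → 𝔸ˣ) A ν κ z)).re) +
      c₀ * (∑ z ∈ box (d := d) (L ^ k * n),
          (τ (star (projRPer τ (L ^ k * n) L k η Λs (1 : B7Prop1Explicit.Site d → Fin d → 𝔸ˣ)
                (covDivB η (1 : B7Prop1Explicit.Site d → Fin d → 𝔸ˣ) A) z) *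
              projRPer τ (L ^ k * n) L k η Λs (1 : B7Prop1Explicit.Site d → Fin d → 𝔸ˣ)
                (covDivB η (1 : B7Prop1Explicit.Site d → Fin d → 𝔸ˣ) A) z)).re) +
      a * ‖QtorusW (L ^ k) (fun _ : Fin d => n) (Nat.one_le_pow k L hL) φ (fun _ => (1 : 𝔸ˣ)) (α := 0) (by norm_num)
            (hU1_one (L ^ k) (fun _ : Fin d => n)) (hreg_one (L ^ k) (fun _ : Fin d => n)) (c₁ := c₁)
            ((WL2.equiv ℂ (fun _ : Bond d (fineP (L ^ k) (fun _ : Fin d => n)) => c₀) (EuclideanSpace ℂ (Fin n'))).symm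
              fun b => φ.symm (A (liftSite b.1) b.2))‖ ^ 2 := by
  set x : BondL2K ℂ d (fineP (L ^ k) (fun _ : Fin d => n)) c₀ (EuclideanSpace ℂ (Fin n')) :=
    (WL2.equiv ℂ (fun _ : Bond d (fineP (L ^ k) (fun _ : Fin d => n)) => c₀) (EuclideanSpace ℂ (Fin n'))).symm
      fun b => φ.symm (A (liftSite b.1) b.2) with hx
  -- the reading of `x_A` is `A`
  have hread : (fun w μ => φ (WL2.equiv ℂ _ _ x (perSite (fineP (L ^ k) (fun _ : Fin d => n)) w, μ))) = A := by
    funext w μ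
    rw [hx, Equiv.apply_symm_apply, LinearEquiv.apply_symm_apply]
    exact comp_perSite_liftSite_restrict (L ^ k * n) (B9Eq327GreenZdHermPer.isPeriodic_apply_dir hAper μ) w
  have hHerm : ∀ (w : B7Prop1Explicit.Site d) (μ : Fin d), IsSelfAdjoint (φ (WL2.equiv ℂ _ _ x (perSite (fineP (L ^ k) (fun _ : Fin d => n)) w, μ))) :=
    fun w μ => by rw [congr_fun (congr_fun hread w) μ]; exact hAherm w μ
  have hread' : ∀ (w : B7Prop1Explicit.Site d) (μ : Fin d), φ (WL2.equiv ℂ _ _ x (perSite (fineP (L ^ k) (fun _ : Fin d => n)) w, μ)) = A w μ :=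
    fun w μ => congr_fun (congr_fun hread w) μ
  have h := flat_coercive_read_mixed L k n τ η a φ (c₁ := c₁) hτs hτp hτt hφ hL hη0 hηL ha Λs hΛk hΛlt x hHerm
  simp only [hread'] at h
  exact h

end Coercive

end Literature.MathematicalPhysics.QuantumFieldTheory.Balaban1983to89.B9Eq190FlatCoercivityZdPer

end
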